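import Literature.AlgebraicGeometry.Motives.HodgeLieSemisimpleTimesAbelian
import Literature.AlgebraicGeometry.Motives.HodgeLieIsomorphismInvariance
import Literature.AlgebraicGeometry.Motives.HodgeThetaSubalgebraRankThree
import Literature.AlgebraicGeometry.Motives.HodgeThetaSubalgebraSymplecticRankFour
import Literature.AlgebraicGeometry.Motives.HodgeThetaSubalgebraRealPlacesSl2
import Literature.Algebra.Lie.GoursatSimpleFactor
import HarnessLib

/-!
# `𝔥(H₁ ⊕ H₂) = 𝔥(H₁) × 𝔥(H₂)` when the factors are `Θ`-rigid and `𝔥(H₁)` is simple — unless `𝔥(H₂)` maps onto `𝔥(H₁)`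
# (Moonen–Zarhin 1999 §3 (3.1): `Hg(X₁ × X₂) ⊆ Hg(X₁) × Hg(X₂)` with surjective projections, plus Goursat's lemma; Lie form)

Family `hodge`, layer `Literature/AlgebraicGeometry/Motives`; THEOREMS ONLY (no definition, no named fact).  Written for the cell
`pub-hodgecm2` (COR-CM), seat `b27` gen 47 (count-neutral Mumford–Tate-rank ladder: the exact table of `dim MT(H¹(E × S))` for a
curve `E` and a surface `S`).  Sequel of `Motives/HodgeLieSemisimpleTimesAbelian` (`𝔥(H₁ ⊕ H₂) = 𝔥(H₁) × 𝔥(H₂)` for `𝔥(H₁)`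
centre-free and `𝔥(H₂)` ABELIAN); here BOTH factors may be non-abelian.

SETTING.  `H ≅ H₁ ⊕ H₂` a pure `ℚ`-Hodge structure decomposed by morphisms `ι_i : H_i → H`, `π_i : H → H_i` (`π_i ι_i = id`,
`ι₁ π₁ + ι₂ π₂ = id`).  The RESTRICTIONS `r_i : 𝔥(H) → 𝔥(H_i)`, `X ↦ π_i X ι_i` (`comp_mem_hodgeLie_of_retract`) are Lie-algebra
homomorphisms (§1: `π (XY) ι = (π X ι)(π Y ι)`, because `Y ι = ι (π Y ι)` for `Y` commuting with the Hodge idempotent `ι π`), they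
are JOINTLY injective (`X = ι₁ r₁(X) π₁ + ι₂ r₂(X) π₂`, `eq_sum_blocks_of_mem_hodgeLie`), and the complex span of `r_i(𝔥(H))`
contains a Hodge operator `Θ_i` of `H_i` (`exists_theta_mem_span_restrict`).  Moonen–Zarhin's «the two projections
`Hg(X₁ × X₂) → Hg(X_i)` are surjective» is a statement about `ℚ`-algebraic groups (minimality of `Hg`); for the tree's `hodgeLie`
(the annihilator of all Hodge tensors) we obtain it from the `Θ`-RIGIDITY of the factor — HYPOTHESIS `hrig_i`: every bracket-closed
rational subspace `𝔞 ⊆ 𝔥(H_i)` whose complex span contains a Hodge operator of `H_i` contains `𝔥(H_i)` — which the tree PROVES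
for the factors that occur (the `Θ`-subalgebra theorems `Motives/HodgeThetaSubalgebraRankThree` (non-CM curves, QM surfaces),
`…SymplecticRankFour` (`End = ℚ` surfaces), `…RealPlacesSl2` (real multiplication), `…SymplecticRankSix`, `…Unitary`).

RESULTS.
* §1 `comp_incl_eq_incl_comp_restrict`, `restrict_mul` — `Y ι = ι (π Y ι)` and `π (X Y) ι = (π X ι)(π Y ι)` on `𝔥(H)`;
  `exists_lieHom_restrict` — the restriction as a Lie homomorphism between Lie subalgebras with carriers `𝔥(H)`, `𝔥(H_i)`.
* §2 **`hodgeLie_eq_map_restrict_of_rigid`** — under `hrig_i`: `𝔥(H_i) = r_i(𝔥(H))` (the projection is ONTO).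
* §3 **`finrank_hodgeLie_eq_add_or_exists_ideal_of_rigid`** — under `hrig₁`, `hrig₂` and SIMPLICITY of `𝔥(H₁)`: EITHER
  `dim 𝔥(H) = dim 𝔥(H₁) + dim 𝔥(H₂)`, OR `dim 𝔥(H) = dim 𝔥(H₂)` and `𝔥(H₂)` has a Lie ideal of codimension `dim 𝔥(H₁)` (the
  kernel of `r₁ ∘ r₂⁻¹ : 𝔥(H₂) ↠ 𝔥(H₁)`) — Goursat's lemma `GoursatSimpleFactor.finrank_eq_add_or_exists_ideal`;
  **`finrank_hodgeLie_eq_add_of_rigid_of_isSimple_of_finrank_ne`** — if also `𝔥(H₂)` is simple of a different dimension, the sum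
  formula holds; **`finrank_hodgeLie_eq_add_of_rigid_of_isSemisimple`** — the same if `𝔥(H₂)` is semisimple with
  `dim 𝔥(H₂) − dim 𝔥(H₁) ∈ {1, 2, 4, 5, 7}`.
* §4 The rigidity hypothesis DISCHARGED from the tree's `Θ`-subalgebra theorems: `rigid_of_finrank_hodgeLie_le_three` (weight one,
  `dim 𝔥 ≤ 3`, `𝔥 ⊄ End_Hdg`: `HodgeThetaSubalgebraRankThree`), `rigid_of_rankFour_of_endAlg_eq_bot` (weight one, `dim V = 4`,
  `End_Hdg = ℚ`: `HodgeThetaSubalgebraSymplecticRankFour`), `rigid_of_realPlaces` (odd weight, real characters with two-dimensional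
  eigenblocks: `HodgeThetaSubalgebraRealPlacesSl2`).
For complex abelian varieties (`CorCM/MumfordTateRankCurveTimesSurface`): `dim MT(H¹(E × S)) = 10` resp. `14` for a non-CM
elliptic curve `E` and a simple surface `S` with real multiplication resp. `End⁰S = ℚ`.

## References
* [MoonenZarhin1999LowDim] B. Moonen, Yu. Zarhin, *Hodge classes on abelian varieties of low dimension*, Math. Ann. 315 (1999),
  §3 (3.1) («`Hg(X₁ × X₂)` is an algebraic subgroup of `Hg(X₁) × Hg(X₂)`; the two projections are surjective») and Lemma (3.6)
  [corpus: paper:arxiv-math_9901113 p. 6]. [cite: MoonenZarhin1999LowDim, §3 (3.1)]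
* [Hazama1983] F. Hazama, *Algebraic cycles on abelian varieties with many real endomorphisms*, Tôhoku Math. J. 35 (1983), §3
  Lemma (3.1) (Goursat's lemma). [cite: Hazama1983, Lemma (3.1)]
* [Deligne1982HodgeCycles] P. Deligne, *Hodge cycles on abelian varieties*, LNM 900 (1982), I §3.1 and Prop. 3.4 (minimality of
  the Mumford–Tate group). [cite: Deligne1982HodgeCycles, I §3.1 and Prop. 3.4]
-/

noncomputable section

namespace Literature.AlgebraicGeometry.Motives

namespace HodgeStructure

attribute [local instance 100] LieRing.ofAssociativeRing

universe u

variable {V₁ : Type u} [AddCommGroup V₁] [Module ℚ V₁] [Module.Finite ℚ V₁]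
  {V₂ : Type u} [AddCommGroup V₂] [Module ℚ V₂] [Module.Finite ℚ V₂]
  {V : Type u} [AddCommGroup V] [Module ℚ V] [Module.Finite ℚ V] [HodgeTensorFacts.{u, u}] {n : ℤ}
  {H₁ : HodgeStructure V₁ n} {H₂ : HodgeStructure V₂ n} {H : HodgeStructure V n}

/-! ### §1 The restriction `X ↦ π X ι` to a direct summand is a Lie homomorphism on `𝔥(H)` -/

section Restrict

variable (ι : Hom H₁ H) (π : Hom H H₁) (hπι : ∀ v, π.toLinearMap (ι.toLinearMap v) = v)

omit [Module.Finite ℚ V₁] in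
include hπι in
/-- **`Y ι = ι (π Y ι)` for `Y ∈ 𝔥(H)` and a retract `π ι = id`**: `Y` commutes with the Hodge endomorphism `e = ι π`
(`commute_of_mem_hodgeLie`) and `e ι = ι`. [cite: Deligne1982HodgeCycles, I §3.1 and Prop. 3.4] -/
theorem comp_incl_eq_incl_comp_restrict {Y : Module.End ℚ V} (hY : Y ∈ H.hodgeLie) :
    Y ∘ₗ ι.toLinearMap = ι.toLinearMap ∘ₗ (π.toLinearMap ∘ₗ Y ∘ₗ ι.toLinearMap) := by
  have he : ι.toLinearMap ∘ₗ π.toLinearMap ∈ H.endAlg := Hom.toLinearMap_mem_endAlg (ι.comp π)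
  have hYe : Y * (ι.toLinearMap ∘ₗ π.toLinearMap) = (ι.toLinearMap ∘ₗ π.toLinearMap) * Y :=
    commute_of_mem_hodgeLie H hY ⟨_, he⟩
  refine LinearMap.ext fun v => ?_
  have h := LinearMap.congr_fun hYe (ι.toLinearMap v)
  simp only [Module.End.mul_apply, LinearMap.comp_apply, hπι] at h
  simp only [LinearMap.comp_apply]
  exact h

omit [Module.Finite ℚ V₁] in
include hπι in
/-- **The restriction is multiplicative on `𝔥(H)`: `π (X Y) ι = (π X ι) (π Y ι)`** (`Y ι = ι (π Y ι)` and `π ι = id`), hence a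
homomorphism of Lie algebras for the commutator brackets. [cite: MoonenZarhin1999LowDim, §3 (3.1)] -/
theorem restrict_mul {X Y : Module.End ℚ V} (hY : Y ∈ H.hodgeLie) :
    π.toLinearMap ∘ₗ (X * Y) ∘ₗ ι.toLinearMap =
      (π.toLinearMap ∘ₗ X ∘ₗ ι.toLinearMap) * (π.toLinearMap ∘ₗ Y ∘ₗ ι.toLinearMap) := by
  have h := comp_incl_eq_incl_comp_restrict ι π hπι hY
  refine LinearMap.ext fun v => ?_
  have hv := LinearMap.congr_fun h v
  simp only [LinearMap.comp_apply] at hv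
  simp only [LinearMap.comp_apply, Module.End.mul_apply]
  rw [hv]
  simp only [hπι]

include hπι in
/-- **The restriction `r : 𝔥(H) → 𝔥(H₁)`, `X ↦ π X ι`, as a homomorphism of Lie algebras** between the Lie subalgebras of
`𝔤𝔩(V)`, `𝔤𝔩(V₁)` with carriers `𝔥(H)`, `𝔥(H₁)` (values in `𝔥(H₁)` by `comp_mem_hodgeLie_of_retract`).
[cite: MoonenZarhin1999LowDim, §3 (3.1)] [cite: Deligne1982HodgeCycles, I §3.1 and Prop. 3.4] -/
theorem exists_lieHom_restrict (𝔏 : LieSubalgebra ℚ (Module.End ℚ V)) (h𝔏 : 𝔏.toSubmodule = H.hodgeLie)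
    (𝔏₁ : LieSubalgebra ℚ (Module.End ℚ V₁)) (h𝔏₁ : 𝔏₁.toSubmodule = H₁.hodgeLie) :
    ∃ f : 𝔏 →ₗ⁅ℚ⁆ 𝔏₁, ∀ X : 𝔏, ((f X : 𝔏₁) : Module.End ℚ V₁) = π.toLinearMap ∘ₗ (X : Module.End ℚ V) ∘ₗ ι.toLinearMap := by
  have hmem : ∀ X : 𝔏, (X : Module.End ℚ V) ∈ H.hodgeLie := fun X => by
    rw [← h𝔏]; exact X.2
  have hmem₁ : ∀ X : 𝔏, π.toLinearMap ∘ₗ (X : Module.End ℚ V) ∘ₗ ι.toLinearMap ∈ 𝔏₁ := fun X => by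
    rw [← LieSubalgebra.mem_toSubmodule, h𝔏₁]
    exact comp_mem_hodgeLie_of_retract ι π hπι (hmem X)
  refine ⟨{ toFun := fun X => ⟨_, hmem₁ X⟩
            map_add' := fun X Y => Subtype.ext (by
              change π.toLinearMap ∘ₗ ((X : Module.End ℚ V) + (Y : Module.End ℚ V)) ∘ₗ ι.toLinearMap =
                π.toLinearMap ∘ₗ (X : Module.End ℚ V) ∘ₗ ι.toLinearMap +
                  π.toLinearMap ∘ₗ (Y : Module.End ℚ V) ∘ₗ ι.toLinearMap
              rw [LinearMap.add_comp, LinearMap.comp_add])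
            map_smul' := fun c X => Subtype.ext (by
              change π.toLinearMap ∘ₗ (c • (X : Module.End ℚ V)) ∘ₗ ι.toLinearMap =
                c • (π.toLinearMap ∘ₗ (X : Module.End ℚ V) ∘ₗ ι.toLinearMap)
              rw [LinearMap.smul_comp, LinearMap.comp_smul])
            map_lie' := fun {X Y} => Subtype.ext ?_ }, fun X => rfl⟩
  change π.toLinearMap ∘ₗ (⁅(X : Module.End ℚ V), (Y : Module.End ℚ V)⁆) ∘ₗ ι.toLinearMap =
    ⁅π.toLinearMap ∘ₗ (X : Module.End ℚ V) ∘ₗ ι.toLinearMap, π.toLinearMap ∘ₗ (Y : Module.End ℚ V) ∘ₗ ι.toLinearMap⁆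
  simp only [LieRing.of_associative_ring_bracket]
  rw [show ((X : Module.End ℚ V) * Y - Y * X) = (X : Module.End ℚ V) * Y + (-((Y : Module.End ℚ V) * X)) from
    sub_eq_add_neg _ _, LinearMap.add_comp, LinearMap.comp_add, LinearMap.neg_comp, LinearMap.comp_neg,
    restrict_mul ι π hπι (hmem Y), restrict_mul ι π hπι (hmem X), ← sub_eq_add_neg]

end Restrict

/-! ### §2 `Θ`-rigidity of a factor makes the projection onto it surjective -/

section Rigid

variable (ι : Hom H₁ H) (π : Hom H H₁) (hπι : ∀ v, π.toLinearMap (ι.toLinearMap v) = v)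

include hπι in
/-- **The projection `𝔥(H) → 𝔥(H₁)` is ONTO when `H₁` is `Θ`-rigid.**  The image `𝔞 = π 𝔥(H) ι ⊆ 𝔥(H₁)` is closed under the
commutator (`restrict_mul`) and its complex span contains a Hodge operator `Θ₁` of `H₁` (`exists_theta_mem_span_restrict`); the
rigidity hypothesis `hrig` — every such `𝔞` contains `𝔥(H₁)` — gives `𝔞 = 𝔥(H₁)`.  (Moonen–Zarhin: «the two projections are
surjective», by the minimality of `Hg`; here the minimality is the hypothesis `hrig`, a theorem of the tree for the factors used.)
[cite: MoonenZarhin1999LowDim, §3 (3.1)] [cite: Deligne1982HodgeCycles, I §3.1 and Prop. 3.4] -/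
theorem hodgeLie_eq_map_restrict_of_rigid
    (hrig : ∀ 𝔞 : Submodule ℚ (Module.End ℚ V₁), 𝔞 ≤ H₁.hodgeLie →
      (∀ X ∈ 𝔞, ∀ Y ∈ 𝔞, X * Y - Y * X ∈ 𝔞) →
      (∃ Θ ∈ Submodule.span ℂ ((fun X : Module.End ℚ V₁ => X.baseChange ℂ) '' (𝔞 : Set (Module.End ℚ V₁))),
        ∀ p, ∀ x ∈ H₁.piece p (n - p), Θ x = ((2 * p - n : ℤ) : ℂ) • x) → H₁.hodgeLie ≤ 𝔞) :
    H₁.hodgeLie = H.hodgeLie.map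
      ((LinearMap.llcomp ℚ V₁ V V₁ π.toLinearMap).comp (LinearMap.lcomp ℚ V ι.toLinearMap)) := by
  set r := (LinearMap.llcomp ℚ V₁ V V₁ π.toLinearMap).comp (LinearMap.lcomp ℚ V ι.toLinearMap) with hr
  have hr_apply : ∀ X : Module.End ℚ V, r X = π.toLinearMap ∘ₗ X ∘ₗ ι.toLinearMap := fun X => rfl
  have hle : H.hodgeLie.map r ≤ H₁.hodgeLie := by
    rintro _ ⟨X, hX, rfl⟩
    rw [hr_apply]
    exact comp_mem_hodgeLie_of_retract ι π hπι hX
  refine le_antisymm (hrig _ hle ?_ ?_) hle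
  · rintro _ ⟨X, hX, rfl⟩ _ ⟨Y, hY, rfl⟩
    refine ⟨X * Y - Y * X, H.commutator_mem_hodgeLie hX hY, ?_⟩
    rw [hr_apply, hr_apply, hr_apply, ← restrict_mul ι π hπι hY, ← restrict_mul ι π hπι hX]
    refine LinearMap.ext fun v => ?_
    simp only [LinearMap.comp_apply, LinearMap.sub_apply, Module.End.mul_apply, map_sub]
  · obtain ⟨Θ, hΘmem, hΘ⟩ := exists_theta_mem_span_restrict ι π hπι
    refine ⟨Θ, ?_, hΘ⟩
    have hset : ((fun X : Module.End ℚ V => π.toLinearMap ∘ₗ X ∘ₗ ι.toLinearMap) '' (H.hodgeLie : Set (Module.End ℚ V))) =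
        ((H.hodgeLie.map r : Submodule ℚ (Module.End ℚ V₁)) : Set (Module.End ℚ V₁)) := by
      rw [Submodule.map_coe]
      exact Set.image_congr fun X _ => (hr_apply X).symm
    rw [← hset]
    exact hΘmem

include hπι in
/-- Surjectivity, pointwise: under `Θ`-rigidity of `H₁`, every `Y ∈ 𝔥(H₁)` is `π X ι` for some `X ∈ 𝔥(H)`.
[cite: MoonenZarhin1999LowDim, §3 (3.1)] -/
theorem exists_restrict_eq_of_rigid
    (hrig : ∀ 𝔞 : Submodule ℚ (Module.End ℚ V₁), 𝔞 ≤ H₁.hodgeLie →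
      (∀ X ∈ 𝔞, ∀ Y ∈ 𝔞, X * Y - Y * X ∈ 𝔞) →
      (∃ Θ ∈ Submodule.span ℂ ((fun X : Module.End ℚ V₁ => X.baseChange ℂ) '' (𝔞 : Set (Module.End ℚ V₁))),
        ∀ p, ∀ x ∈ H₁.piece p (n - p), Θ x = ((2 * p - n : ℤ) : ℂ) • x) → H₁.hodgeLie ≤ 𝔞)
    {Y : Module.End ℚ V₁} (hY : Y ∈ H₁.hodgeLie) :
    ∃ X ∈ H.hodgeLie, π.toLinearMap ∘ₗ X ∘ₗ ι.toLinearMap = Y := by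
  rw [hodgeLie_eq_map_restrict_of_rigid ι π hπι hrig] at hY
  obtain ⟨X, hX, rfl⟩ := hY
  exact ⟨X, hX, rfl⟩

end Rigid

/-! ### §3 Goursat: `dim 𝔥(H) = dim 𝔥(H₁) + dim 𝔥(H₂)` unless `𝔥(H₂)` maps onto the simple `𝔥(H₁)` -/

section Main

variable (ι₁ : Hom H₁ H) (π₁ : Hom H H₁) (ι₂ : Hom H₂ H) (π₂ : Hom H H₂)
  (hπι₁ : ∀ v, π₁.toLinearMap (ι₁.toLinearMap v) = v) (hπι₂ : ∀ v, π₂.toLinearMap (ι₂.toLinearMap v) = v)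
  (hsum : ∀ v, ι₁.toLinearMap (π₁.toLinearMap v) + ι₂.toLinearMap (π₂.toLinearMap v) = v)
  (hrig₁ : ∀ 𝔞 : Submodule ℚ (Module.End ℚ V₁), 𝔞 ≤ H₁.hodgeLie →
      (∀ X ∈ 𝔞, ∀ Y ∈ 𝔞, X * Y - Y * X ∈ 𝔞) →
      (∃ Θ ∈ Submodule.span ℂ ((fun X : Module.End ℚ V₁ => X.baseChange ℂ) '' (𝔞 : Set (Module.End ℚ V₁))),
        ∀ p, ∀ x ∈ H₁.piece p (n - p), Θ x = ((2 * p - n : ℤ) : ℂ) • x) → H₁.hodgeLie ≤ 𝔞)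
  (hrig₂ : ∀ 𝔞 : Submodule ℚ (Module.End ℚ V₂), 𝔞 ≤ H₂.hodgeLie →
      (∀ X ∈ 𝔞, ∀ Y ∈ 𝔞, X * Y - Y * X ∈ 𝔞) →
      (∃ Θ ∈ Submodule.span ℂ ((fun X : Module.End ℚ V₂ => X.baseChange ℂ) '' (𝔞 : Set (Module.End ℚ V₂))),
        ∀ p, ∀ x ∈ H₂.piece p (n - p), Θ x = ((2 * p - n : ℤ) : ℂ) • x) → H₂.hodgeLie ≤ 𝔞)

include hπι₁ hπι₂ hsum hrig₁ hrig₂ in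
/-- **Goursat for `𝔥(H₁ ⊕ H₂)`.**  Let `H ≅ H₁ ⊕ H₂` with `Θ`-rigid factors, and let `𝔥(H₁)` be a simple Lie algebra (for
some / every Lie subalgebra `𝔏₁ ⊆ 𝔤𝔩(V₁)` with carrier `𝔥(H₁)`).  Then EITHER `dim 𝔥(H) = dim 𝔥(H₁) + dim 𝔥(H₂)`
(`𝔥(H) = 𝔥(H₁) × 𝔥(H₂)`), OR `dim 𝔥(H) = dim 𝔥(H₂)` and the Lie algebra `𝔥(H₂)` has an ideal `I` with
`dim I + dim 𝔥(H₁) = dim 𝔥(H₂)` (the restriction `r₂ : 𝔥(H) ≅ 𝔥(H₂)` is bijective and `r₁ ∘ r₂⁻¹ : 𝔥(H₂) ↠ 𝔥(H₁)` has kernel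
`I`).  The restrictions `r_i` are surjective Lie homomorphisms (§1–§2) with `ker r₁ ∩ ker r₂ = 0`
(`eq_sum_blocks_of_mem_hodgeLie`), and `GoursatSimpleFactor.finrank_eq_add_or_exists_ideal` applies.
[cite: MoonenZarhin1999LowDim, §3 (3.1)] [cite: Hazama1983, Lemma (3.1)] -/
theorem finrank_hodgeLie_eq_add_or_exists_ideal_of_rigid
    (𝔏₁ : LieSubalgebra ℚ (Module.End ℚ V₁)) (h𝔏₁ : 𝔏₁.toSubmodule = H₁.hodgeLie) [LieAlgebra.IsSimple ℚ 𝔏₁]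
    (𝔏₂ : LieSubalgebra ℚ (Module.End ℚ V₂)) (h𝔏₂ : 𝔏₂.toSubmodule = H₂.hodgeLie) :
    Module.finrank ℚ H.hodgeLie = Module.finrank ℚ H₁.hodgeLie + Module.finrank ℚ H₂.hodgeLie ∨
      (Module.finrank ℚ H.hodgeLie = Module.finrank ℚ H₂.hodgeLie ∧
        ∃ I : LieIdeal ℚ 𝔏₂, Module.finrank ℚ I + Module.finrank ℚ H₁.hodgeLie = Module.finrank ℚ H₂.hodgeLie) := by
  obtain ⟨𝔏, h𝔏⟩ := exists_lieSubalgebra_eq_hodgeLie H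
  obtain ⟨f, hf⟩ := exists_lieHom_restrict ι₁ π₁ hπι₁ 𝔏 h𝔏 𝔏₁ h𝔏₁
  obtain ⟨g, hg⟩ := exists_lieHom_restrict ι₂ π₂ hπι₂ 𝔏 h𝔏 𝔏₂ h𝔏₂
  have hmem : ∀ X : 𝔏, (X : Module.End ℚ V) ∈ H.hodgeLie := fun X => by rw [← h𝔏]; exact X.2
  haveI : Module.Finite ℚ 𝔏₁ := Module.Finite.of_injective 𝔏₁.toSubmodule.subtype Subtype.val_injective
  haveI : Module.Finite ℚ 𝔏₂ := Module.Finite.of_injective 𝔏₂.toSubmodule.subtype Subtype.val_injective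
  -- finrank bookkeeping
  have e𝔏 : Module.finrank ℚ 𝔏 = Module.finrank ℚ H.hodgeLie := by
    rw [← h𝔏]; rfl
  have e𝔏₁ : Module.finrank ℚ 𝔏₁ = Module.finrank ℚ H₁.hodgeLie := by
    rw [← h𝔏₁]; rfl
  have e𝔏₂ : Module.finrank ℚ 𝔏₂ = Module.finrank ℚ H₂.hodgeLie := by
    rw [← h𝔏₂]; rfl
  -- surjectivity of the restrictions
  have hfs : Function.Surjective f := by
    rintro ⟨Y, hY⟩
    have hY' : Y ∈ H₁.hodgeLie := by rw [← h𝔏₁]; exact hY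
    obtain ⟨X, hX, hXY⟩ := exists_restrict_eq_of_rigid ι₁ π₁ hπι₁ hrig₁ hY'
    refine ⟨⟨X, by rw [← LieSubalgebra.mem_toSubmodule, h𝔏]; exact hX⟩, Subtype.ext ?_⟩
    rw [hf]; exact hXY
  have hgs : Function.Surjective g := by
    rintro ⟨Y, hY⟩
    have hY' : Y ∈ H₂.hodgeLie := by rw [← h𝔏₂]; exact hY
    obtain ⟨X, hX, hXY⟩ := exists_restrict_eq_of_rigid ι₂ π₂ hπι₂ hrig₂ hY'
    refine ⟨⟨X, by rw [← LieSubalgebra.mem_toSubmodule, h𝔏]; exact hX⟩, Subtype.ext ?_⟩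
    rw [hg]; exact hXY
  -- joint injectivity
  have hker : f.ker ⊓ g.ker = ⊥ := by
    rw [eq_bot_iff]
    intro X hX
    rw [LieSubmodule.mem_inf, LieHom.mem_ker, LieHom.mem_ker] at hX
    rw [LieSubmodule.mem_bot]
    apply Subtype.ext
    have h1 : π₁.toLinearMap ∘ₗ (X : Module.End ℚ V) ∘ₗ ι₁.toLinearMap = 0 := by
      rw [← hf, hX.1]; rfl
    have h2 : π₂.toLinearMap ∘ₗ (X : Module.End ℚ V) ∘ₗ ι₂.toLinearMap = 0 := by
      rw [← hg, hX.2]; rfl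
    have h := eq_sum_blocks_of_mem_hodgeLie ι₁ π₁ ι₂ π₂ hπι₁ hπι₂ hsum (hmem X)
    rw [h1, h2, LinearMap.zero_comp, LinearMap.comp_zero, LinearMap.zero_comp, LinearMap.comp_zero, add_zero] at h
    exact h
  rcases Literature.Algebra.Lie.GoursatSimpleFactor.finrank_eq_add_or_exists_ideal f g hfs hgs hker with
    ⟨h, -⟩ | ⟨hginj, I, hI⟩
  · left
    rw [← e𝔏, ← e𝔏₁, ← e𝔏₂]
    exact h
  · right
    refine ⟨?_, I, by rw [← e𝔏₁, ← e𝔏₂]; exact hI⟩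
    rw [← e𝔏, ← e𝔏₂]
    exact LinearEquiv.finrank_eq (LinearEquiv.ofBijective (g : 𝔏 →ₗ[ℚ] 𝔏₂) ⟨hginj, hgs⟩)

include hπι₁ hπι₂ hsum hrig₁ hrig₂ in
/-- **`dim 𝔥(H₁ ⊕ H₂) = dim 𝔥(H₁) + dim 𝔥(H₂)` for `Θ`-rigid factors with SIMPLE Hodge Lie algebras of DIFFERENT dimensions**
(an ideal of the simple `𝔥(H₂)` of codimension `dim 𝔥(H₁) ∉ {0, dim 𝔥(H₂)}` does not exist).  E.g. `H¹(E) ⊕ H¹(S)` for a non-CM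
elliptic curve (`𝔰𝔩₂`, dimension `3`) and a simple surface with real multiplication (`Res_{K/ℚ} 𝔰𝔩₂`, `ℚ`-simple of dimension `6`).
[cite: MoonenZarhin1999LowDim, §3 (3.1)] [cite: Hazama1983, Lemma (3.1)] -/
theorem finrank_hodgeLie_eq_add_of_rigid_of_isSimple_of_finrank_ne
    (𝔏₁ : LieSubalgebra ℚ (Module.End ℚ V₁)) (h𝔏₁ : 𝔏₁.toSubmodule = H₁.hodgeLie) [LieAlgebra.IsSimple ℚ 𝔏₁]
    (𝔏₂ : LieSubalgebra ℚ (Module.End ℚ V₂)) (h𝔏₂ : 𝔏₂.toSubmodule = H₂.hodgeLie) [LieAlgebra.IsSimple ℚ 𝔏₂]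
    (hne : Module.finrank ℚ H₁.hodgeLie ≠ Module.finrank ℚ H₂.hodgeLie) :
    Module.finrank ℚ H.hodgeLie = Module.finrank ℚ H₁.hodgeLie + Module.finrank ℚ H₂.hodgeLie := by
  rcases finrank_hodgeLie_eq_add_or_exists_ideal_of_rigid ι₁ π₁ ι₂ π₂ hπι₁ hπι₂ hsum hrig₁ hrig₂ 𝔏₁ h𝔏₁ 𝔏₂ h𝔏₂ with
    h | ⟨-, I, hI⟩
  · exact h
  · exfalso
    haveI : Module.Finite ℚ 𝔏₁ := Module.Finite.of_injective 𝔏₁.toSubmodule.subtype Subtype.val_injective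
    haveI : Module.Finite ℚ 𝔏₂ := Module.Finite.of_injective 𝔏₂.toSubmodule.subtype Subtype.val_injective
    have e𝔏₁ : Module.finrank ℚ 𝔏₁ = Module.finrank ℚ H₁.hodgeLie := by rw [← h𝔏₁]; rfl
    have e𝔏₂ : Module.finrank ℚ 𝔏₂ = Module.finrank ℚ H₂.hodgeLie := by rw [← h𝔏₂]; rfl
    have hpos := Literature.Algebra.Lie.GoursatSimpleFactor.finrank_pos_of_isSimple (K := ℚ) (𝔞 := 𝔏₁)
    rcases LieAlgebra.IsSimple.eq_bot_or_eq_top I with h | h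
    · have e : Module.finrank ℚ (⊥ : LieIdeal ℚ 𝔏₂) = Module.finrank ℚ (⊥ : LieIdeal ℚ 𝔏₂).toSubmodule := rfl
      rw [LieSubmodule.bot_toSubmodule, finrank_bot] at e
      rw [h, e] at hI
      exact hne (by omega)
    · have e : Module.finrank ℚ (⊤ : LieIdeal ℚ 𝔏₂) = Module.finrank ℚ (⊤ : LieIdeal ℚ 𝔏₂).toSubmodule := rfl
      rw [LieSubmodule.top_toSubmodule, finrank_top] at e
      rw [h, e] at hI
      omega

include hπι₁ hπι₂ hsum hrig₁ hrig₂ in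
/-- **`dim 𝔥(H₁ ⊕ H₂) = dim 𝔥(H₁) + dim 𝔥(H₂)` for `Θ`-rigid factors, `𝔥(H₁)` simple, `𝔥(H₂)` SEMISIMPLE with
`dim 𝔥(H₂) − dim 𝔥(H₁) ∈ {1, 2, 4, 5, 7}`** (no ideal of a semisimple Lie algebra has such a dimension,
`GoursatSimpleFactor.finrank_lieIdeal_ne`).  E.g. `H¹(E) ⊕ H¹(S)` for a non-CM elliptic curve (`3`) and a surface with `End⁰S = ℚ`
(`𝔰𝔭₄`, `10 = 3 + 7`). [cite: MoonenZarhin1999LowDim, §3 (3.1)] [cite: Hazama1983, Lemma (3.1)] -/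
theorem finrank_hodgeLie_eq_add_of_rigid_of_isSemisimple
    (𝔏₁ : LieSubalgebra ℚ (Module.End ℚ V₁)) (h𝔏₁ : 𝔏₁.toSubmodule = H₁.hodgeLie) [LieAlgebra.IsSimple ℚ 𝔏₁]
    (𝔏₂ : LieSubalgebra ℚ (Module.End ℚ V₂)) (h𝔏₂ : 𝔏₂.toSubmodule = H₂.hodgeLie) [LieAlgebra.IsSemisimple ℚ 𝔏₂]
    (hd : Module.finrank ℚ H₂.hodgeLie = Module.finrank ℚ H₁.hodgeLie + 1 ∨
      Module.finrank ℚ H₂.hodgeLie = Module.finrank ℚ H₁.hodgeLie + 2 ∨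
      Module.finrank ℚ H₂.hodgeLie = Module.finrank ℚ H₁.hodgeLie + 4 ∨
      Module.finrank ℚ H₂.hodgeLie = Module.finrank ℚ H₁.hodgeLie + 5 ∨
      Module.finrank ℚ H₂.hodgeLie = Module.finrank ℚ H₁.hodgeLie + 7) :
    Module.finrank ℚ H.hodgeLie = Module.finrank ℚ H₁.hodgeLie + Module.finrank ℚ H₂.hodgeLie := by
  rcases finrank_hodgeLie_eq_add_or_exists_ideal_of_rigid ι₁ π₁ ι₂ π₂ hπι₁ hπι₂ hsum hrig₁ hrig₂ 𝔏₁ h𝔏₁ 𝔏₂ h𝔏₂ with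
    h | ⟨-, I, hI⟩
  · exact h
  · exfalso
    haveI : Module.Finite ℚ 𝔏₂ := Module.Finite.of_injective 𝔏₂.toSubmodule.subtype Subtype.val_injective
    have hI' := Literature.Algebra.Lie.GoursatSimpleFactor.finrank_lieIdeal_ne (K := ℚ) I
    omega

end Main

/-! ### §4 Rigid factors supplied by the tree's `Θ`-subalgebra theorems -/

section RigidFactors

variable {W : Type u} [AddCommGroup W] [Module ℚ W] [Module.Finite ℚ W]

/-- **A weight-one Hodge structure with `dim 𝔥 ≤ 3` and `𝔥 ⊄ End_Hdg` is `Θ`-rigid** (the Hodge structure `H¹` of a non-CM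
complex abelian variety with `dim MT(H¹) = 4`: a non-CM elliptic curve, a QM surface, their powers): a bracket-closed `𝔞 ⊆ 𝔥(H)` whose
complex span contains a Hodge operator has `𝔞_ℂ ⊇ 𝔥(H)_ℂ` (`hodgeLieC_le_spanC_of_theta_mem`; `𝔞` commutes with `End_Hdg` and is
`ψ`-skew because `𝔥(H)` does), hence `𝔞 ⊇ 𝔥(H)` by descent (`mem_of_baseChange_mem_spanC`).
[cite: Deligne1982HodgeCycles, I §3.1 and Prop. 3.4] [cite: MoonenZarhin1999LowDim, §3 (3.1)] -/
theorem rigid_of_finrank_hodgeLie_le_three (H' : HodgeStructure W n) (ψ : H'.Polarization) (hn : n = 1)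
    (heff : H'.IsEffective) (hne : ¬ H'.hodgeLie ≤ Subalgebra.toSubmodule H'.endAlg)
    (h3 : Module.finrank ℚ H'.hodgeLie ≤ 3) :
    ∀ 𝔞 : Submodule ℚ (Module.End ℚ W), 𝔞 ≤ H'.hodgeLie →
      (∀ X ∈ 𝔞, ∀ Y ∈ 𝔞, X * Y - Y * X ∈ 𝔞) →
      (∃ Θ ∈ Submodule.span ℂ ((fun X : Module.End ℚ W => X.baseChange ℂ) '' (𝔞 : Set (Module.End ℚ W))),
        ∀ p, ∀ x ∈ H'.piece p (n - p), Θ x = ((2 * p - n : ℤ) : ℂ) • x) → H'.hodgeLie ≤ 𝔞 := by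
  intro 𝔞 hle hbr hΘ X hX
  obtain ⟨Θ, hΘ𝔞, hΘ⟩ := hΘ
  have hC : H'.hodgeLieC ≤ spanC 𝔞 :=
    hodgeLieC_le_spanC_of_theta_mem H' ψ hn heff hne h3 hbr
      (fun X' hX' a => commute_of_mem_hodgeLie H' (hle hX') a)
      (fun X' hX' => form_apply_add_eq_zero_of_mem_hodgeLie ψ (hle hX')) hΘ hΘ𝔞
  exact mem_of_baseChange_mem_spanC 𝔞 (hC (baseChange_mem_hodgeLieC H' hX))

/-- **A weight-one Hodge structure of rank `4` with `End_Hdg = ℚ` is `Θ`-rigid** (`H¹` of an abelian surface with `End⁰ = ℚ`,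
`Hg = Sp₄`): the tree's `SymplecticTheta.eq_hodgeLie`. [cite: MoonenZarhin1999LowDim, §2 (2.2) and §3 (3.1)]
[cite: Deligne1982HodgeCycles, I §3.1 and Prop. 3.4] -/
theorem rigid_of_rankFour_of_endAlg_eq_bot (H' : HodgeStructure W n) (ψ : H'.Polarization) (hn : n = 1)
    (heff : H'.IsEffective) (hE : ∀ a ∈ H'.endAlg, ∃ x : ℚ, a = x • 1) (hW : Module.finrank ℚ W = 4) :
    ∀ 𝔞 : Submodule ℚ (Module.End ℚ W), 𝔞 ≤ H'.hodgeLie →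
      (∀ X ∈ 𝔞, ∀ Y ∈ 𝔞, X * Y - Y * X ∈ 𝔞) →
      (∃ Θ ∈ Submodule.span ℂ ((fun X : Module.End ℚ W => X.baseChange ℂ) '' (𝔞 : Set (Module.End ℚ W))),
        ∀ p, ∀ x ∈ H'.piece p (n - p), Θ x = ((2 * p - n : ℤ) : ℂ) • x) → H'.hodgeLie ≤ 𝔞 := by
  intro 𝔞 hle hbr hΘ
  obtain ⟨Θ, hΘ𝔞, hΘ⟩ := hΘ
  rw [← SymplecticTheta.eq_hodgeLie H' hn heff ψ hE hW 𝔞 hbr hΘ hΘ𝔞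
    (fun X' hX' => form_apply_add_eq_zero_of_mem_hodgeLie ψ (hle hX'))]

/-- **A Hodge structure of odd weight whose Hodge endomorphisms are self-adjoint and split `V_ℂ` into two-dimensional real
eigenblocks is `Θ`-rigid** (`H¹` of an abelian variety with real multiplication of relative dimension one, `Hg = R_{E/ℚ} SL₂`):
the tree's `ThetaSubalgebra.eq_hodgeLie`. [cite: Hazama1983, Lemma (3.1)] [cite: Deligne1982HodgeCycles, I §3.1 and Prop. 3.4] -/
theorem rigid_of_realPlaces {ι' : Type*} [Fintype ι'] [DecidableEq ι'] (H' : HodgeStructure W n) (hn : Odd n)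
    (ψ : H'.Polarization)
    (hself : ∀ a : H'.endAlg, LinearMap.IsAdjointPair ψ.form ψ.form (a : Module.End ℚ W) (a : Module.End ℚ W))
    (σ : ι' → (H'.endAlg →+* ℂ)) (hreal : ∀ i, (starRingEnd ℂ).comp (σ i) = σ i)
    (hint : DirectSum.IsInternal fun i => H'.eigenBlock (σ i)) (h2 : ∀ i, Module.finrank ℂ (H'.eigenBlock (σ i)) = 2) :
    ∀ 𝔞 : Submodule ℚ (Module.End ℚ W), 𝔞 ≤ H'.hodgeLie →
      (∀ X ∈ 𝔞, ∀ Y ∈ 𝔞, X * Y - Y * X ∈ 𝔞) →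
      (∃ Θ ∈ Submodule.span ℂ ((fun X : Module.End ℚ W => X.baseChange ℂ) '' (𝔞 : Set (Module.End ℚ W))),
        ∀ p, ∀ x ∈ H'.piece p (n - p), Θ x = ((2 * p - n : ℤ) : ℂ) • x) → H'.hodgeLie ≤ 𝔞 := by
  intro 𝔞 hle hbr hΘ
  obtain ⟨Θ, hΘ𝔞, hΘ⟩ := hΘ
  rw [← ThetaSubalgebra.eq_hodgeLie H' hn ψ hself σ hreal hint h2 𝔞 hbr hΘ hΘ𝔞
    (fun X' hX' a => commute_of_mem_hodgeLie H' (hle hX') a)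
    (fun X' hX' => form_apply_add_eq_zero_of_mem_hodgeLie ψ (hle hX'))]

end RigidFactors

end HodgeStructure

end Literature.AlgebraicGeometry.Motives

end
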